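import Mathlib
import Summits.Ventures.PercRepro2.Defs
import Summits.Ventures.PercRepro2.Graph
import Summits.Ventures.PercRepro2.OneColourSwitch
import Summits.Ventures.PercRepro2.RegionHubSign
import Summits.Ventures.PercRepro2.SideSwitch
import Summits.Ventures.PercRepro2.TermSwitchDefs
import Summits.Ventures.PercRepro2.TermSwitchReach
import Summits.Ventures.PercRepro2.M9NoPocketDefs
import Summits.Ventures.PercRepro2.M9NoPocketWorldD
import Summits.Ventures.PercRepro2.M9GeneralDSplit
import Summits.Ventures.PercRepro2.M9GeneralDHD
import Summits.Ventures.PercRepro2.M9SubcubeHarris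
import Summits.Ventures.PercRepro2.M9ClusterFibreHarris
import Summits.Ventures.PercRepro2.M9ClusterAvoidHarris
import Summits.Ventures.PercRepro2.M9PocketUnitFibre
import Summits.Ventures.PercRepro2.M9PocketUnitFibreSum

/-!
# The hub–dead-end part and the dead configurations of a unit (blind cell PercRepro2,
p3 g39, 2026-08-29; `proofs/P3-POCKETRK.md` §3 and §5‴ (c) in the kernel)

Instances of `sum_konly_noWside_nonpos` (`M9PocketUnitFibreSum`).  The `W`-defect set of a
colouring `ω` — the colourings `ω'` in which `d ~_W p`, `d ~_W q`, or `d ~_W x` for a vertex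
`x ∉ {r, s, d}` of the `Y`-world of `ω` — is a lower set (`isLowerSet_wdefectSet`) constant
on the exploration fibres, and on a `K`-only point it is the `HD` condition
(`HD_konly_iff`, from `hd_iff`).  Hence

* **`sum_konly_HD_noWside_nonpos`**: `Σ_{HD ∧ d ∈ K₂ ∧ no W-side ∧ P} σ_pq · σ_rs ≤ 0` for every
  fibre-invariant `P` — the hub–dead-end `K`-points of a class of units are non-positive;
* the unit instances: `P = «the edges from d into the Y-world of G − d and the edges touching
  the worlds of {r, s} in G − d are those of ρ₀»` is fibre-invariant (`unitDead_invariant`), so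
  **`sum_unit_dead_noWside_nonpos`** (every dead configuration `S(D) ≤ 0` of a unit without
  free blocks, `proofs/P3-POCKETRK.md` §3 — `A = univ`) and
  **`sum_unit_HD_noWside_nonpos`** (the dirty clean points and the dead configurations of a
  unit together, `S_dead + K_dirty ≤ 0`, §3 + §5‴ (c)).

The unit predicate is stated in its `nu`-free form (for a colouring without a `W`-side in
`G − d` the normalisation `nu` is the identity), so that no `Fintype V` instance enters the
sums.  Own work; std axioms.
-/

namespace Summit.Ventures.PercRepro2

namespace NoPocket

open Finset Classical OneColourSwitch SideSwitch

variable {V : Type*} {E : Type*}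

section Pointwise

variable {ends : E → Sym2 V} {p q r s d : V}

/-- The `W`-defect set of `ω` is a lower set: `W`-connections only grow when edges close. -/
lemma isLowerSet_wdefectSet (ω : Config E) :
    IsLowerSet {ω' : Config E | Conn ends (OneColourSwitch.compl ω') d p ∨
      Conn ends (OneColourSwitch.compl ω') d q ∨
      ∃ x, x ≠ r ∧ x ≠ s ∧ x ≠ d ∧ x ∈ K2 ends r s ω ∧
        Conn ends (OneColourSwitch.compl ω') d x} := by
  intro ω₁ ω₂ h hω₁
  have hle := compl_le_compl_of_le h
  simp only [Set.mem_setOf_eq] at hω₁ ⊢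
  rcases hω₁ with h1 | h1 | ⟨x, hxr, hxs, hxd, hxK, hxc⟩
  · exact Or.inl (conn_mono hle h1)
  · exact Or.inr (Or.inl (conn_mono hle h1))
  · exact Or.inr (Or.inr ⟨x, hxr, hxs, hxd, hxK, conn_mono hle hxc⟩)

/-- The `W`-defect set is constant on the exploration fibres. -/
lemma wdefectSet_eq_on_unitFibre (hdr : d ≠ r) (hds : d ≠ s) {ω ω' : Config E}
    (hB : ∀ x ∈ M2 (endsD ends d) r s ω, x = r ∨ x = s)
    (hω' : ∀ e ∈ touches ends (cluster ends ω d ∪ K2 (endsD ends d) r s ω ∪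
      M2 (endsD ends d) r s ω), ω' e = ω e) :
    {ω'' : Config E | Conn ends (OneColourSwitch.compl ω'') d p ∨
      Conn ends (OneColourSwitch.compl ω'') d q ∨
      ∃ x, x ≠ r ∧ x ≠ s ∧ x ≠ d ∧ x ∈ K2 ends r s ω' ∧
        Conn ends (OneColourSwitch.compl ω'') d x} =
    {ω'' : Config E | Conn ends (OneColourSwitch.compl ω'') d p ∨
      Conn ends (OneColourSwitch.compl ω'') d q ∨
      ∃ x, x ≠ r ∧ x ≠ s ∧ x ≠ d ∧ x ∈ K2 ends r s ω ∧
        Conn ends (OneColourSwitch.compl ω'') d x} := by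
  rw [K2_eq_on_unitFibre hdr hds hB hω']

/-- **On a `K`-only point, `HD` is the `W`-defect**: for `d ∈ K₂`,
`HD ω ∧ d ∈ K₂ ↔ Sep ∧ DOne ∧ d ∈ K₂ ∧ d ∉ M₂ ∧ WDefect`. -/
lemma HD_konly_iff {ω : Config E} :
    HD ends p q r s d ω ∧ d ∈ K2 ends r s ω ↔
      sep2 ends p q r s ω ∧ DOne ends r s d ω ∧ d ∈ K2 ends r s ω ∧ d ∉ M2 ends r s ω ∧
        WDefect ends p q r s d ω := by
  constructor
  · rintro ⟨h, hK⟩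
    obtain ⟨hsep, hD, hone⟩ := hd_iff.1 h
    rcases hone with ⟨_, hM, hW⟩ | ⟨_, hK', _⟩
    · exact ⟨hsep, fun x hxr hxs _ hxK => hD x hxr hxs hxK, hK, hM, hW⟩
    · exact (hK' hK).elim
  · rintro ⟨hsep, hD, hK, hM, hW⟩
    refine ⟨hd_iff.2 ⟨hsep, ?_, Or.inl ⟨hK, hM, hW⟩⟩, hK⟩
    intro x hxr hxs hxK
    by_cases hxd : x = d
    · subst hxd; exact hM
    · exact hD x hxr hxs hxd hxK

/-- **The dead-configuration unit predicate is constant on the fibres**: the edges from `d`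
into the `Y`-world of `G − d` and the edges touching the worlds of `{r, s}` in `G − d` touch
`U`. -/
lemma unitDead_invariant (hdr : d ≠ r) (hds : d ≠ s) (ρ₀ : Config E) :
    ∀ ω ω' : Config E, (∀ x ∈ M2 (endsD ends d) r s ω, x = r ∨ x = s) →
      (∀ e ∈ touches ends (cluster ends ω d ∪ K2 (endsD ends d) r s ω ∪
        M2 (endsD ends d) r s ω), ω' e = ω e) →
      ((∀ e y, ends e = s(d, y) → y ∈ K2 (endsD ends d) r s ω → ω e = ρ₀ e) ∧
        ∀ e ∈ touches (endsD ends d) (K2 (endsD ends d) r s ω ∪ M2 (endsD ends d) r s ω),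
          ω e = ρ₀ e) →
      ((∀ e y, ends e = s(d, y) → y ∈ K2 (endsD ends d) r s ω' → ω' e = ρ₀ e) ∧
        ∀ e ∈ touches (endsD ends d) (K2 (endsD ends d) r s ω' ∪ M2 (endsD ends d) r s ω'),
          ω' e = ρ₀ e) := by
  intro ω ω' _ hω' ⟨h1, h2⟩
  rw [K2_endsD_eq_on_unitFibre hdr hds hω', M2_endsD_eq_on_unitFibre hdr hds hω']
  constructor
  · intro e y hey hy
    rw [hω' e ⟨y, Or.inl (Or.inr hy), d, by rw [hey, Sym2.eq_swap]⟩]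
    exact h1 e y hey hy
  · intro e he
    obtain ⟨x, hx, y, hxy⟩ := he
    have hde : d ∉ ends e := by
      intro hde
      rw [endsD_of_mem hde, Sym2.eq_iff] at hxy
      have hxd : x = d := by
        rcases hxy with ⟨h, _⟩ | ⟨_, h⟩ <;> exact h.symm
      subst hxd
      rcases hx with hx | hx
      · exact not_mem_K2_endsD hdr hds ω hx
      · exact not_mem_M2_endsD hdr hds ω hx
    rw [endsD_of_notMem hde] at hxy
    rw [hω' e ⟨x, by
      rcases hx with hx | hx
      · exact Or.inl (Or.inr hx)
      · exact Or.inr hx, y, hxy⟩]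
    exact h2 e ⟨x, hx, y, by rw [endsD_of_notMem hde, hxy]⟩

end Pointwise

section Sum

variable [Fintype E] [DecidableEq E] {ends : E → Sym2 V} {p q r s d : V}

/-- **The hub–dead-end `K`-points without a `W`-side are non-positive**: for every predicate
`P` constant on the fibres, `Σ_{HD ∧ d ∈ K₂ ∧ no W-side ∧ P} σ_pq · σ_rs ≤ 0`. -/
theorem sum_konly_HD_noWside_nonpos (hdr : d ≠ r) (hds : d ≠ s)
    (hrs : within ends ({r, s} : Set V) = ∅) (hT : ∀ e, ends e ≠ s(d, r) ∧ ends e ≠ s(d, s))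
    (P : Config E → Prop)
    (hP : ∀ ω ω' : Config E, (∀ x ∈ M2 (endsD ends d) r s ω, x = r ∨ x = s) →
      (∀ e ∈ touches ends (cluster ends ω d ∪ K2 (endsD ends d) r s ω ∪
        M2 (endsD ends d) r s ω), ω' e = ω e) → P ω → P ω') :
    (∑ ω : Config E, if HD ends p q r s d ω ∧ d ∈ K2 ends r s ω ∧
        (∀ x ∈ M2 (endsD ends d) r s ω, x = r ∨ x = s) ∧ P ω then
      sigma ends ω p q * sigma ends ω r s else 0) ≤ 0 := by
  have key := sum_konly_noWside_nonpos (p := p) (q := q) hdr hds hrs hT P hP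
    (fun ω => {ω' : Config E | Conn ends (OneColourSwitch.compl ω') d p ∨
      Conn ends (OneColourSwitch.compl ω') d q ∨
      ∃ x, x ≠ r ∧ x ≠ s ∧ x ≠ d ∧ x ∈ K2 ends r s ω ∧
        Conn ends (OneColourSwitch.compl ω') d x})
    (fun ω => isLowerSet_wdefectSet ω)
    (fun ω ω' hB hω' => wdefectSet_eq_on_unitFibre hdr hds hB hω')
  refine le_trans (le_of_eq (Finset.sum_congr rfl fun ω _ => ?_)) key
  have hiff : (HD ends p q r s d ω ∧ d ∈ K2 ends r s ω ∧
      (∀ x ∈ M2 (endsD ends d) r s ω, x = r ∨ x = s) ∧ P ω) ↔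
      (sep2 ends p q r s ω ∧ DOne ends r s d ω ∧ d ∈ K2 ends r s ω ∧ d ∉ M2 ends r s ω ∧
        (∀ x ∈ M2 (endsD ends d) r s ω, x = r ∨ x = s) ∧ P ω ∧
        ω ∈ {ω' : Config E | Conn ends (OneColourSwitch.compl ω') d p ∨
          Conn ends (OneColourSwitch.compl ω') d q ∨
          ∃ x, x ≠ r ∧ x ≠ s ∧ x ≠ d ∧ x ∈ K2 ends r s ω ∧
            Conn ends (OneColourSwitch.compl ω') d x}) := by
    constructor
    · rintro ⟨h, hK, hB, hPω⟩
      obtain ⟨hsep, hD, _, hM, hW⟩ := HD_konly_iff.1 ⟨h, hK⟩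
      exact ⟨hsep, hD, hK, hM, hB, hPω, hW⟩
    · rintro ⟨hsep, hD, hK, hM, hB, hPω, hW⟩
      exact ⟨(HD_konly_iff.2 ⟨hsep, hD, hK, hM, hW⟩).1, hK, hB, hPω⟩
  by_cases h : HD ends p q r s d ω ∧ d ∈ K2 ends r s ω ∧
      (∀ x ∈ M2 (endsD ends d) r s ω, x = r ∨ x = s) ∧ P ω
  · rw [if_pos h, if_pos (hiff.1 h)]
  · rw [if_neg h, if_neg (fun h' => h (hiff.2 h'))]

/-- **Every dead configuration of a unit without free blocks is non-positive**
(`proofs/P3-POCKETRK.md` §3, `S(D) ≤ 0`): the `K`-only points of the unit of `ρ₀` with the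
edges from `d` into the blocks those of `ρ₀`. -/
theorem sum_unit_dead_noWside_nonpos (hdr : d ≠ r) (hds : d ≠ s)
    (hrs : within ends ({r, s} : Set V) = ∅) (hT : ∀ e, ends e ≠ s(d, r) ∧ ends e ≠ s(d, s))
    (ρ₀ : Config E) :
    (∑ ω : Config E, if sep2 ends p q r s ω ∧ DOne ends r s d ω ∧ d ∈ K2 ends r s ω ∧
        d ∉ M2 ends r s ω ∧ (∀ x ∈ M2 (endsD ends d) r s ω, x = r ∨ x = s) ∧
        ((∀ e y, ends e = s(d, y) → y ∈ K2 (endsD ends d) r s ω → ω e = ρ₀ e) ∧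
          ∀ e ∈ touches (endsD ends d) (K2 (endsD ends d) r s ω ∪ M2 (endsD ends d) r s ω),
            ω e = ρ₀ e) then
      sigma ends ω p q * sigma ends ω r s else 0) ≤ 0 := by
  have key := sum_konly_noWside_nonpos (p := p) (q := q) hdr hds hrs hT
    (fun ω => (∀ e y, ends e = s(d, y) → y ∈ K2 (endsD ends d) r s ω → ω e = ρ₀ e) ∧
      ∀ e ∈ touches (endsD ends d) (K2 (endsD ends d) r s ω ∪ M2 (endsD ends d) r s ω),
        ω e = ρ₀ e)
    (unitDead_invariant hdr hds ρ₀) (fun _ => Set.univ) (fun _ => isLowerSet_univ)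
    (fun _ _ _ _ => rfl)
  refine le_trans (le_of_eq (Finset.sum_congr rfl fun ω _ => ?_)) key
  by_cases h : sep2 ends p q r s ω ∧ DOne ends r s d ω ∧ d ∈ K2 ends r s ω ∧
      d ∉ M2 ends r s ω ∧ (∀ x ∈ M2 (endsD ends d) r s ω, x = r ∨ x = s) ∧
      ((∀ e y, ends e = s(d, y) → y ∈ K2 (endsD ends d) r s ω → ω e = ρ₀ e) ∧
        ∀ e ∈ touches (endsD ends d) (K2 (endsD ends d) r s ω ∪ M2 (endsD ends d) r s ω),
          ω e = ρ₀ e)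
  · rw [if_pos h, if_pos ⟨h.1, h.2.1, h.2.2.1, h.2.2.2.1, h.2.2.2.2.1, h.2.2.2.2.2,
      Set.mem_univ ω⟩]
  · rw [if_neg h, if_neg (fun h' => h ⟨h'.1, h'.2.1, h'.2.2.1, h'.2.2.2.1, h'.2.2.2.2.1,
      h'.2.2.2.2.2.1⟩)]

/-- **The hub–dead-end `K`-points of a unit without free blocks are non-positive**
(`proofs/P3-POCKETRK.md` §3 + §5‴ (c): `S_dead + K_dirty ≤ 0`). -/
theorem sum_unit_HD_noWside_nonpos (hdr : d ≠ r) (hds : d ≠ s)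
    (hrs : within ends ({r, s} : Set V) = ∅) (hT : ∀ e, ends e ≠ s(d, r) ∧ ends e ≠ s(d, s))
    (ρ₀ : Config E) :
    (∑ ω : Config E, if HD ends p q r s d ω ∧ d ∈ K2 ends r s ω ∧
        (∀ x ∈ M2 (endsD ends d) r s ω, x = r ∨ x = s) ∧
        ((∀ e y, ends e = s(d, y) → y ∈ K2 (endsD ends d) r s ω → ω e = ρ₀ e) ∧
          ∀ e ∈ touches (endsD ends d) (K2 (endsD ends d) r s ω ∪ M2 (endsD ends d) r s ω),
            ω e = ρ₀ e) then
      sigma ends ω p q * sigma ends ω r s else 0) ≤ 0 := by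
  have key := sum_konly_HD_noWside_nonpos (p := p) (q := q) hdr hds hrs hT
    (fun ω => (∀ e y, ends e = s(d, y) → y ∈ K2 (endsD ends d) r s ω → ω e = ρ₀ e) ∧
      ∀ e ∈ touches (endsD ends d) (K2 (endsD ends d) r s ω ∪ M2 (endsD ends d) r s ω),
        ω e = ρ₀ e)
    (unitDead_invariant hdr hds ρ₀)
  refine le_trans (le_of_eq (Finset.sum_congr rfl fun ω _ => ?_)) key
  by_cases h : HD ends p q r s d ω ∧ d ∈ K2 ends r s ω ∧
      (∀ x ∈ M2 (endsD ends d) r s ω, x = r ∨ x = s) ∧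
      ((∀ e y, ends e = s(d, y) → y ∈ K2 (endsD ends d) r s ω → ω e = ρ₀ e) ∧
        ∀ e ∈ touches (endsD ends d) (K2 (endsD ends d) r s ω ∪ M2 (endsD ends d) r s ω),
          ω e = ρ₀ e)
  · rw [if_pos h, if_pos ⟨h.1, h.2.1, h.2.2.1, h.2.2.2⟩]
  · rw [if_neg h, if_neg (fun h' => h ⟨h'.1, h'.2.1, h'.2.2.1, h'.2.2.2⟩)]

end Sum

end NoPocket

end Summit.Ventures.PercRepro2
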